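import Summits.Langlands.Langlands.Theorems.SoloBlindCMDescent
import HarnessLib

/-!
# SoloBlindParallelType — regular algebraic cusp forms over a field with a real place have
# infinity type parallel over the maximal real subfield; over a complex cubic field, parallel

Solo seat `solo-Langlands-blind`, session 10.  A consequence of the seat's kernel theorem
`SoloBlind.map_a_eq_of_isRegularAlgebraic` (Patrikis's CM descent of the infinity type, obtained
from the vendored named fact `Clozel1990_regularAlgebraic` alone):

* `map_a_eq_of_eqOn_maximalRealSubfield` — if the number field `K` has a real place (i.e. is not
  totally complex) then `K` has no CM subfield, every CM-or-totally-real subfield of `K` lies in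
  the maximal real subfield `K⁺`, and hence for every cuspidal regular algebraic `π` on
  `GL_n(𝔸_K)` the multiset of holomorphic weights `a` of any infinity type `T` of `π` is the same at
  any two embeddings `K → ℂ` agreeing on `K⁺`;
* `map_a_eq_of_finrank_prime` — if moreover `[K:ℚ]` is prime and `K` is not totally real then
  `K⁺ = ℚ`, so the `a`-multiset of `T` is the same at ALL embeddings ("`T` is parallel");
* `map_a_eq_of_complexCubic` / `not_exists_map_a_ne_of_complexCubic` — the case of a complex
  cubic field (`[K:ℚ] = 3`, `K` not totally real; a real place exists because the degree is odd,
  `not_isTotallyComplex_of_odd_finrank`).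

Consequence recorded by the seat (paper/paper.md §3–§5, s10 correction): the "dihedral door"
setting — a cuspidal cohomological `π` on `GL_2` over a complex cubic field `K` with DIFFERENT
weights at the real and at the complex place of `K` (weight-regularity (WR)) — is EMPTY: such a `π`
would be regular algebraic with `a`-multisets `{n_u/2, -n_u/2}` differing at the real and the
complex embedding, contradicting `map_a_eq_of_complexCubic`.  The same holds for every number
field of prime degree with mixed signature (e.g. the `D_5`-quintic fields with one complex place
pair do not qualify, but those with signature (1,2) or (3,1) do).

Inputs: `Clozel1990_regularAlgebraic` (as a hypothesis) and Mathlib's theory of totally real /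
totally complex fields and of intermediate fields of prime degree
(`IntermediateField.isSimpleOrder_of_finrank_prime`).
[cite: Clozel1990, Thm. 3.13 and Lemme 4.9] [cite: Patrikis2019, Prop. 2.4.7 and Rem. 2.4.8 (1)
(arXiv:1207.6724 §3.2)]
-/

open scoped Classical
open NumberField NumberField.ComplexEmbedding Module
open Literature.NumberTheory.NumberFields Literature.NumberTheory.Automorphic

namespace Summit.Langlands.Langlands.Theorems
namespace SoloBlind

/-! ### Field lemmas -/

section FieldLemmas

variable {K : Type*} [Field K] [NumberField K]

/-- A number field of odd degree has a real place. -/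
theorem not_isTotallyComplex_of_odd_finrank (hodd : Odd (finrank ℚ K)) :
    ¬ IsTotallyComplex K := by
  intro h
  have h2 : finrank ℚ K = 2 * InfinitePlace.nrComplexPlaces K := IsTotallyComplex.finrank K
  exact (Nat.not_even_iff_odd.mpr hodd) ⟨InfinitePlace.nrComplexPlaces K, by omega⟩

/-- A number field with a real place has no CM subfield. -/
theorem not_isCMField_subfield_of_not_isTotallyComplex (hc : ¬ IsTotallyComplex K)
    (M : Subfield K) : ¬ IsCMField M := by
  intro hM
  haveI : IsTotallyComplex M := hM.to_isTotallyComplex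
  exact hc (isTotallyComplex_of_algebra M K)

/-- In a number field with a real place, every CM-or-totally-real subfield lies in the maximal
real subfield. -/
theorem le_maximalRealSubfield_of_isCMField_or_isTotallyReal (hc : ¬ IsTotallyComplex K)
    (M : Subfield K) (hM : IsCMField M ∨ IsTotallyReal M) : M ≤ maximalRealSubfield K := by
  rcases hM with hM | hM
  · exact absurd hM (not_isCMField_subfield_of_not_isTotallyComplex hc M)
  · exact IsTotallyReal.le_maximalRealSubfield M

/-- In a number field of prime degree every subfield is either `ℚ` (all its elements are
rational) or everything. -/
theorem forall_mem_exists_ratCast_or_eq_top_of_finrank_prime (hp : (finrank ℚ K).Prime)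
    (M : Subfield K) : (∀ x ∈ M, ∃ q : ℚ, (q : K) = x) ∨ M = ⊤ := by
  haveI := IntermediateField.isSimpleOrder_of_finrank_prime ℚ K hp
  let E : IntermediateField ℚ K :=
    M.toIntermediateField fun q ↦ by simp
  rcases eq_bot_or_eq_top E with hE | hE
  · refine Or.inl fun x hx ↦ ?_
    have hxE : x ∈ E := hx
    rw [hE, IntermediateField.mem_bot] at hxE
    obtain ⟨q, hq⟩ := hxE
    exact ⟨q, by simpa using hq⟩
  · refine Or.inr (top_unique fun x _ ↦ ?_)
    have hxE : x ∈ E := by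
      rw [hE]
      exact IntermediateField.mem_top
    exact hxE

/-- In a number field of prime degree which is not totally real, every element of the maximal
real subfield is rational. -/
theorem exists_ratCast_of_mem_maximalRealSubfield_of_finrank_prime (hp : (finrank ℚ K).Prime)
    (hr : ¬ IsTotallyReal K) {x : K} (hx : x ∈ maximalRealSubfield K) : ∃ q : ℚ, (q : K) = x := by
  rcases forall_mem_exists_ratCast_or_eq_top_of_finrank_prime hp (maximalRealSubfield K) with
    h | h
  · exact h x hx
  · exact absurd ((maximalRealSubfield_eq_top_iff_isTotallyReal (K := K)).mp h) hr

/-- Two ring homomorphisms out of a number field of prime degree with mixed signature agree on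
every CM-or-totally-real subfield. -/
theorem ringHom_apply_eq_of_mem_of_finrank_prime {L : Type*} [Field L] [CharZero L]
    (hp : (finrank ℚ K).Prime) (hr : ¬ IsTotallyReal K) (hc : ¬ IsTotallyComplex K)
    (ι ι' : K →+* L) (M : Subfield K) (hM : IsCMField M ∨ IsTotallyReal M) {x : K} (hx : x ∈ M) :
    ι x = ι' x := by
  obtain ⟨q, rfl⟩ := exists_ratCast_of_mem_maximalRealSubfield_of_finrank_prime hp hr
    (le_maximalRealSubfield_of_isCMField_or_isTotallyReal hc M hM hx)
  simp

end FieldLemmas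

/-! ### Parallel infinity types -/

section Main

variable {K : Type} [Field K] [NumberField K] {n : ℕ} {hcpt : isCompact_glFiniteIntegralLevel n K}

/-- **Parallel over the maximal real subfield.**  Granted `Clozel1990_regularAlgebraic`: if `K`
has a real place, `π` is a cuspidal regular algebraic representation of `GL_n(𝔸_K)` and `T` an
infinity type of `π`, then the `a`-multisets of `T` agree at any two embeddings agreeing on the
maximal real subfield `K⁺`. [cite: Patrikis2019, Prop. 2.4.7 and Rem. 2.4.8 (1)]
[cite: Clozel1990, Thm. 3.13 and Lemme 4.9] -/
theorem map_a_eq_of_eqOn_maximalRealSubfield (hC : Clozel1990_regularAlgebraic)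
    (hc : ¬ IsTotallyComplex K) (π : CuspidalAutomorphicRepData n K hcpt)
    (hπ : π.1.IsRegularAlgebraic) {T : InfinityType K n} (hT : π.1.HasInfinityType T)
    {ι ι' : K →+* ℂ} (hιι' : ∀ x ∈ maximalRealSubfield K, ι x = ι' x) :
    (T ι).map ArchWeight.a = (T ι').map ArchWeight.a :=
  map_a_eq_of_isRegularAlgebraic hC π hπ hT fun M hM _x hx ↦
    hιι' _ (le_maximalRealSubfield_of_isCMField_or_isTotallyReal hc M hM hx)

/-- **Parallel type in prime degree with mixed signature.**  Granted
`Clozel1990_regularAlgebraic`: if `[K:ℚ]` is prime and `K` is neither totally real nor totally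
complex, then for every cuspidal regular algebraic `π` on `GL_n(𝔸_K)` the `a`-multiset of an
infinity type `T` of `π` is the same at every embedding `K → ℂ`.
[cite: Patrikis2019, Prop. 2.4.7 and Rem. 2.4.8 (1)] [cite: Clozel1990, Thm. 3.13 and Lemme 4.9] -/
theorem map_a_eq_of_finrank_prime (hC : Clozel1990_regularAlgebraic)
    (hp : (finrank ℚ K).Prime) (hr : ¬ IsTotallyReal K) (hc : ¬ IsTotallyComplex K)
    (π : CuspidalAutomorphicRepData n K hcpt) (hπ : π.1.IsRegularAlgebraic)
    {T : InfinityType K n} (hT : π.1.HasInfinityType T) (ι ι' : K →+* ℂ) :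
    (T ι).map ArchWeight.a = (T ι').map ArchWeight.a :=
  map_a_eq_of_isRegularAlgebraic hC π hπ hT fun M hM _x hx ↦
    ringHom_apply_eq_of_mem_of_finrank_prime hp hr hc ι ι' M hM hx

/-- **Parallel type over a complex cubic field.**  Granted `Clozel1990_regularAlgebraic`: over a
cubic number field `K` which is not totally real, every cuspidal regular algebraic `π` on
`GL_n(𝔸_K)` has the same `a`-multiset at all three embeddings `K → ℂ` — in particular the same
weights at the real place and at the complex place.
[cite: Patrikis2019, Prop. 2.4.7 and Rem. 2.4.8 (1)] [cite: Clozel1990, Thm. 3.13 and Lemme 4.9] -/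
theorem map_a_eq_of_complexCubic (hC : Clozel1990_regularAlgebraic)
    (h3 : finrank ℚ K = 3) (hr : ¬ IsTotallyReal K)
    (π : CuspidalAutomorphicRepData n K hcpt) (hπ : π.1.IsRegularAlgebraic)
    {T : InfinityType K n} (hT : π.1.HasInfinityType T) (ι ι' : K →+* ℂ) :
    (T ι).map ArchWeight.a = (T ι').map ArchWeight.a :=
  map_a_eq_of_finrank_prime hC (h3 ▸ Nat.prime_three) hr
    (not_isTotallyComplex_of_odd_finrank (h3 ▸ (by decide : Odd 3))) π hπ hT ι ι'

/-- **The weight-regular door is empty over a complex cubic field.**  Granted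
`Clozel1990_regularAlgebraic`: there is no cuspidal regular algebraic `π` on `GL_n(𝔸_K)`, `K` a
complex cubic field, with an infinity type whose `a`-multisets differ at two embeddings (e.g.
different weights at the real and the complex place).
[cite: Patrikis2019, Prop. 2.4.7 and Rem. 2.4.8 (1)] [cite: Clozel1990, Thm. 3.13 and Lemme 4.9] -/
theorem not_exists_map_a_ne_of_complexCubic (hC : Clozel1990_regularAlgebraic)
    (h3 : finrank ℚ K = 3) (hr : ¬ IsTotallyReal K) :
    ¬ ∃ (π : CuspidalAutomorphicRepData n K hcpt) (T : InfinityType K n) (ι ι' : K →+* ℂ),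
        π.1.IsRegularAlgebraic ∧ π.1.HasInfinityType T ∧
          (T ι).map ArchWeight.a ≠ (T ι').map ArchWeight.a := by
  rintro ⟨π, T, ι, ι', hπ, hT, hne⟩
  exact hne (map_a_eq_of_complexCubic hC h3 hr π hπ hT ι ι')

/-- The same over any number field of prime degree with mixed signature. -/
theorem not_exists_map_a_ne_of_finrank_prime (hC : Clozel1990_regularAlgebraic)
    (hp : (finrank ℚ K).Prime) (hr : ¬ IsTotallyReal K) (hc : ¬ IsTotallyComplex K) :
    ¬ ∃ (π : CuspidalAutomorphicRepData n K hcpt) (T : InfinityType K n) (ι ι' : K →+* ℂ),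
        π.1.IsRegularAlgebraic ∧ π.1.HasInfinityType T ∧
          (T ι).map ArchWeight.a ≠ (T ι').map ArchWeight.a := by
  rintro ⟨π, T, ι, ι', hπ, hT, hne⟩
  exact hne (map_a_eq_of_finrank_prime hC hp hr hc π hπ hT ι ι')

end Main

end SoloBlind
end Summit.Langlands.Langlands.Theorems
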